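import Mathlib.NumberTheory.Padics.PadicVal.Basic
import Mathlib.Algebra.BigOperators.Group.Finset.Basic
import HarnessLib

/-!
# Class X11b, route "BDP + converse-theorem engine + Kolyvagin": the degree-ratio step of the Shimura-curve Gross–Zagier display — Pasten's switching argument at a non-Eisenstein prime (cell `b2b-bsdres`, sub-cell `multr1-p2`, gen 10)

HONEST FRAMING (verbatim, cell `b2b-bsdres`): the goal of the cell is to DELETE the
COMBINATION-SHAPED residual classes for ALL analytic-rank `≤ 1` curves over `ℚ` — "full BSD
formula for every rank `≤ 1` curve in class `C`" assembled STRICTLY from published theorems — so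
that the rank-`≤ 1` remainder becomes exactly the CONSTRUCTION-SHAPED classes, which are TYPED
(missing-input Props), NOT attempted; this is not "finishing BSD". Research route `p2` for class
X11b; no claim beyond the stated class; nothing booked; X11b stays CONSTRUCTION-SHAPED. THEOREMS
ONLY (no definition, no named fact). Nothing here is a theorem about Shimura curves or Néron
models: it is the ARITHMETIC of Pasten's refinement of the Ribet–Takahashi formula, run at a prime
`ℓ` at which the image terms vanish, over displayed integer identities.

## Why (the audit of gen 9's display (GZ-Sh))

Gen 9 (`BDPRouteUpperLinks*.lean`, `BDPRouteUpperField.lean`) reduced the Euler-system half of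
`BSD(E,p)` on the sub-atom (T2β)∖(T2α) of X11b (41 174 class-wide pairs) to two DISPLAYED statements
at the CM point of a Jetchev–Skinner–Wan field `K″` on the Shimura curve `X_{N⁺,N⁻}`: (U-Sh) =
JSW 2017 Thm. 4.4.1 and (GZ-Sh) = "`2·ord_p[E(K″):ℤz] = ord_p(L'(E,1)/(ΩReg)·L(E^{D″},1)/Ω_{D″})
− ord_p ∏_{ℓ∣N⁻} c_ℓ(E/K″)`" (JSW 2017 §7.4.2, arXiv:1512.06894 p. 31). The second display is the
explicit Gross–Zagier formula on `X_{N⁺,N⁻}` (Yuan–Zhang–Zhang, Cai–Shu–Tian) TOGETHER WITH the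
degree-ratio identity "`δ(N,1)/δ(N⁺,N⁻) = ∏_{ℓ∣N⁻} c_ℓ(E/K″)` up to a `p`-adic unit", which JSW take
from W. Zhang 2014 (Camb. J. Math. 2, p. 245: "by the theorem of Ribet–Takahashi (the second part of
[RT97, Theorem 1], cf. the proof of Theorem 6.4)"; proof of Thm. 6.4, p. 229: valid when "`#Ram(ρ̄) ≥ 1`
and either `Ram(ρ̄)` contains a prime `ℓ ∥ N⁻` or there are at least two prime factors `ℓ ∥ N⁺`",
for `p ∤ N`). At `p ∥ N` (class X11b) NO refereed source prints that identity; the general source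
announced for it, Takahashi 2001 (J. Number Theory 90) Thm. 2.4 / (V), has a known gap
(Papikian–Rabinoff 2016 §1 p. 4 and §4 p. 11: "Theorem 2.4 in [Takahashi] claims that `π_*` is
surjective in this case. The proof … crucially relies on a result of Bertolini and Darmon [BD].
Unfortunately, the proof of this latter proposition has a gap"; Pasten 2024 (arXiv v4 p. 31): "This gap affects
the main result of [Takahashi]").

What IS printed (Pasten, J. Number Theory 254 (2024) = arXiv:1705.09251 §6, refereed; notation:
`N = DM` admissible, `q_{D,M} : J₀^D(M) → A_{D,M}` the optimal quotient, `δ_{D,M}` its degree,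
`c_q(·)` the number of geometric components at `q`, and for a prime `q` (arXiv v4 p. 30)
`i_q(D,M) = #image`, `j_q(D,M) = #cokernel` of `q_{D,M,q,*} : Φ_q(J₀^D(M)) → Φ_q(A_{D,M})`):

* (P613) Prop. 6.13 (arXiv v4 p. 30) (= Ribet–Takahashi 1997 Thm. 2; "the proof in loc. cit. does not need
  `M` to be squarefree … one just needs multiplicative reduction at the two primes"): for `D = dpr`,
  `δ_{d,prM}/δ_{dpr,M} = c_p(A_{d,prM})·c_r(A_{dpr,M}) / (i_p(d,prM)²·j_r(dpr,M)²)` (and the same with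
  `p`, `r` exchanged);
* (Pij) `i_q(D,M)·j_q(D,M) = #Φ_q(A_{D,M}) = c_q(A_{D,M})` (image and cokernel of a homomorphism into
  the cyclic group `Φ_q(A_{D,M})` of order `c_q(A_{D,M})`, `q` multiplicative — used on p. 31: "by
  definition `j_p(D,M)` divides `c_p(A_{D,M}) = #Φ_p(A_{D,M})`");
* (P68) proof of Lemma 6.8 (arXiv v4 p. 29): for an isogeny `A → B` of minimal degree `n`, "the numerator of
  `c_p(A)/c_p(B)` divides `n`, and similarly for the denominator" — at a prime `ℓ` with `E[ℓ]`
  irreducible every minimal isogeny inside the class has degree prime to `ℓ`, so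
  `ord_ℓ c_q(A_{D,M}) = ord_ℓ c_q(E)`;
* (PEis) proof of Lemma 6.14 (arXiv v4 p. 31) (Ribet's Eisenstein property of `Φ_p(J₀^D(M))`, `p ∥ M`): "`i_p`
  divides `r + 1 − a_r(A_{D,M})` for every prime `r ∤ N`" — at a prime `ℓ` with `E[ℓ]` irreducible
  there is such an `r` with `ℓ ∤ r + 1 − a_r` (Chebotarev; tree theorem
  `exists_prime_not_dvd_lFunction_sub_of_hasIrreducibleModPGaloisRep`), so `ord_ℓ i_p = 0`;
* (P618) Lemma 6.18 (arXiv v4 p. 33) (from Papikian–Rabinoff 2016 Cor. 3.5): `j_q(D,M) ∣ q − 1` for odd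
  `q ∣ D`.

## What this file proves (abstractly: `δ, cA, ι, κ` are functions on finite sets of primes, `c q = c_q(E)`)

At a prime `ℓ` at which the image terms have valuation `0` and `ord_ℓ c_q(A_•) = ord_ℓ c_q(E)`
(the non-Eisenstein reading of (P68)/(PEis), derived here from their divisibility forms in
`padicValNat_eq_of_dvd_mul_of_dvd_mul` / `padicValNat_eq_zero_of_int_dvd_of_not_dvd`):

* `padicValNat_coker_eq_of_pair` — Lemma 6.15 at `ℓ`: the cokernel valuations at two primes of the
  same `D` agree; hence `padicValNat_coker_eq_zero_of_witness_mem`: if `D` contains a prime `ℓ₀` with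
  `ℓ ∤ c_{ℓ₀}(E)` (a (ram) witness), EVERY cokernel term of level `D` is an `ℓ`-adic unit;
* `padicValNat_coker_eq_zero_of_two_outside` — Lemma 6.16 at `ℓ`: if two further multiplicative
  primes `r ≠ t` lie OUTSIDE `D` and `ℓ ∤ c_r(E)`, every cokernel term of level `D` is an `ℓ`-adic
  unit (the four-level switching identity (EqEXP1) = (EqEXP2), arXiv v4 p. 32);
* `padicValNat_delta_empty_eq_of_witness` — the telescoping (§6.9 (EqSequentially)): for `S` even
  with a (ram) witness `ℓ₀` and one more multiplicative prime `t ∉ S`, `t ≠ ℓ₀` (in class X11b: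
  `t = p`, the BSD prime itself, which divides `N⁺`),
  `ord_ℓ δ(∅) = ord_ℓ δ(S) + Σ_{q∈S} ord_ℓ c_q(E)` — the EXACT degree-ratio identity (DEG) that
  (GZ-Sh) needs, with no Takahashi 2001 input and no condition on `N⁺`;
* `padicValNat_delta_empty_eq_of_pairing` — the same from (P618) alone when half of `S` consists of
  primes `q` with `ℓ ∤ q − 1` (the rescue available in JSW's own `p ∤ N` setting, where `N⁺ = q₁`
  has a single multiplicative prime and Lemma 6.16 does not apply).

Consumer: `X11b/BDPRouteUpperDegree.lean` (the end form with (T2♯) replaced by (T2♯-RT)), via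
`X11b/BDPRouteRTDegreeTelescope.lean`. CONDITIONAL on displayed shapes in the consumer; nothing
booked; labels unchanged.

(Gate note: the same seven theorems were first proposed as `X11b/BDPRouteDegreeRatio.lean`, p214626,
namespace `…X11b.DegreeRatio`; that proposal is stuck QUEUED on a gate-internal `index.lock`
failure, so this module — namespace `…X11b.RTDegree` — supersedes it; no declaration is shared.)

## References

* [PastenShimura2024] H. Pasten, J. Number Theory 254 (2024) 214–335 = arXiv:1705.09251, §6.2
  (6.1), Lemma 6.8 (arXiv v4 p. 29), §6.6 and Prop. 6.13 (p. 30), Lemma 6.14 (p. 31), §6.7 Lemmas 6.15/6.16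
  (pp. 31–32) and p. 31 (the gap in Takahashi 2001), Lemma 6.18 and §6.9 (p. 33); folios of arXiv:1705.09251v4.
* [PapikianRabinoff2016] M. Papikian, J. Rabinoff, Canad. J. Math. 68 (2016) = arXiv:1212.3574,
  §1 (p. 4), Cor. 3.5, §4 (p. 11).
* [RibetTakahashi1997] K. Ribet, S. Takahashi, PNAS 94 (1997), Thm. 1, Thm. 2 (text not held:
  acq-02186). [Takahashi2001] J. Number Theory 90, Thm. 2.4 (gapped). [Takahashi2009JP] (acq-09128).
* [WZhang2014] W. Zhang, Camb. J. Math. 2 (2014), proof of Thm. 6.4 (p. 229), §10 (p. 245).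
* [JetchevSkinnerWan2017] Camb. J. Math. 5 (2017) = arXiv:1512.06894, §7.4.2 (p. 31).
-/

open Finset

namespace Summit.BirchSwinnertonDyer.Rank1Residual.X11b.RTDegree

variable {ℓ : ℕ} [Fact ℓ.Prime]

/-! ### Two readings at a prime `ℓ`: (P68) and (PEis) in divisibility form give valuation statements -/

/-- **(P68) at `ℓ`**: if `a ∣ n·b`, `b ∣ n·a` with `ℓ ∤ n` and `a, b > 0` then `ord_ℓ a = ord_ℓ b`
(Pasten 2024, proof of Lemma 6.8: numerator and denominator of `c_q(A)/c_q(B)` divide the degree `n`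
of a minimal isogeny; `ℓ ∤ n` when `E[ℓ]` is irreducible). [cite: PastenShimura2024, Lemma 6.8 (proof, arXiv v4 p. 29)] -/
theorem padicValNat_eq_of_dvd_mul_of_dvd_mul {a b n : ℕ} (ha : 0 < a) (hb : 0 < b) (hn : ¬ ℓ ∣ n)
    (hab : a ∣ n * b) (hba : b ∣ n * a) : padicValNat ℓ a = padicValNat ℓ b := by
  have hℓ : ℓ.Prime := Fact.out
  have hn0 : n ≠ 0 := by rintro rfl; exact hn (dvd_zero ℓ)
  have hvn : padicValNat ℓ n = 0 := padicValNat.eq_zero_of_not_dvd hn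
  have h1 : padicValNat ℓ a ≤ padicValNat ℓ (n * b) :=
    (padicValNat_dvd_iff_le (mul_ne_zero hn0 hb.ne')).mp
      (dvd_trans pow_padicValNat_dvd hab)
  have h2 : padicValNat ℓ b ≤ padicValNat ℓ (n * a) :=
    (padicValNat_dvd_iff_le (mul_ne_zero hn0 ha.ne')).mp
      (dvd_trans pow_padicValNat_dvd hba)
  rw [padicValNat.mul hn0 hb.ne', hvn, zero_add] at h1
  rw [padicValNat.mul hn0 ha.ne', hvn, zero_add] at h2
  exact le_antisymm h1 h2

omit [Fact ℓ.Prime] in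
/-- **(PEis) at `ℓ`**: if the positive integer `i` divides an integer `x` with `ℓ ∤ x` then
`ord_ℓ i = 0` (Pasten 2024, proof of Lemma 6.14: `i_p ∣ r + 1 − a_r` for every good prime `r`;
at a non-Eisenstein `ℓ` some `r` has `ℓ ∤ r + 1 − a_r`). [cite: PastenShimura2024, Lemma 6.14 (proof, arXiv v4 p. 31)] -/
theorem padicValNat_eq_zero_of_int_dvd_of_not_dvd {i : ℕ} {x : ℤ} (hix : (i : ℤ) ∣ x)
    (hx : ¬ (ℓ : ℤ) ∣ x) : padicValNat ℓ i = 0 := by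
  by_contra h
  have h1 : 1 ≤ padicValNat ℓ i := Nat.one_le_iff_ne_zero.mpr h
  have hℓi : ℓ ∣ i := dvd_of_one_le_padicValNat h1
  exact hx (dvd_trans (Int.natCast_dvd_natCast.mpr hℓi) hix)

/-! ### The abstract Ribet–Takahashi package at a non-Eisenstein prime -/

section Package

/-
Abstract data (see the module docstring): `Mult` = the primes of multiplicative reduction of `E`
(`ℓ` itself may belong to it); for a finite set `D ⊆ Mult` of even cardinality (the discriminant of
the indefinite quaternion algebra; `M = N/∏D`), `δ D = δ_{D,M}`; for `q ∈ Mult`, `cA D q = c_q(A_{D,M})`,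
`ι D q = i_q(D,M)`, `κ D q = j_q(D,M)`; `c q = c_q(E) = ord_q Δ_min(E)`.
-/

variable {Mult : Finset ℕ} {δ : Finset ℕ → ℕ} {cA ι κ : Finset ℕ → ℕ → ℕ} {c : ℕ → ℕ}
  -- (P613) Pasten Prop. 6.13 (both expressions, by symmetry in `q`, `r`)
  (h613 : ∀ ⦃d : Finset ℕ⦄, d ⊆ Mult → Even d.card → ∀ ⦃q r : ℕ⦄, q ∈ Mult → r ∈ Mult →
    q ∉ d → r ∉ d → q ≠ r →
    δ d * ι d q ^ 2 * κ (insert q (insert r d)) r ^ 2 =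
      δ (insert q (insert r d)) * cA d q * cA (insert q (insert r d)) r)
  -- positivity of degrees and component numbers
  (hδ : ∀ D, 0 < δ D) (hcA : ∀ D q, 0 < cA D q)
  -- (Pij) image · cokernel = `#Φ_q(A_{D,M}) = c_q(A_{D,M})`
  (hij : ∀ ⦃D : Finset ℕ⦄, D ⊆ Mult → ∀ ⦃q : ℕ⦄, q ∈ Mult → ι D q * κ D q = cA D q)
  -- (P68) at `ℓ`: `ord_ℓ c_q(A_{D,M}) = ord_ℓ c_q(E)`
  (hvA : ∀ ⦃D : Finset ℕ⦄, D ⊆ Mult → ∀ ⦃q : ℕ⦄, q ∈ Mult →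
    padicValNat ℓ (cA D q) = padicValNat ℓ (c q))
  -- (PEis) at `ℓ`: the image terms are `ℓ`-adic units
  (hι : ∀ ⦃d : Finset ℕ⦄, d ⊆ Mult → ∀ ⦃q : ℕ⦄, q ∈ Mult → q ∉ d → padicValNat ℓ (ι d q) = 0)

include h613 hδ hcA hij hvA hι

/-- **The valuation form of (P613) at `ℓ`** (one telescoping step, Pasten §6.9 (EqSequentially) read
at a prime `ℓ` where the image term is a unit and `ord_ℓ c_q(A) = ord_ℓ c_q(E)`): for `D = d ∪ {q, r}`,
`ord_ℓ δ(d) + 2·ord_ℓ j_r(D) = ord_ℓ δ(D) + ord_ℓ c_q(E) + ord_ℓ c_r(E)`.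
[cite: PastenShimura2024, Prop. 6.13 (arXiv v4 p. 30) and §6.9 (EqSequentially) (p. 33)] -/
theorem padicValNat_step
    {d : Finset ℕ} (hd : d ⊆ Mult) (hde : Even d.card) {q r : ℕ} (hq : q ∈ Mult) (hr : r ∈ Mult)
    (hqd : q ∉ d) (hrd : r ∉ d) (hqr : q ≠ r) :
    padicValNat ℓ (δ d) + 2 * padicValNat ℓ (κ (insert q (insert r d)) r) =
      padicValNat ℓ (δ (insert q (insert r d))) + padicValNat ℓ (c q) + padicValNat ℓ (c r) := by
  set D := insert q (insert r d) with hD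
  have hDsub : D ⊆ Mult := by
    rw [hD]
    exact Finset.insert_subset_iff.mpr ⟨hq, Finset.insert_subset_iff.mpr ⟨hr, hd⟩⟩
  have hιne : ι d q ≠ 0 := by
    intro h0
    have := hij hd hq
    rw [h0, zero_mul] at this
    exact (hcA d q).ne' this.symm
  have hκne : κ D r ≠ 0 := by
    intro h0
    have := hij hDsub hr
    rw [h0, mul_zero] at this
    exact (hcA D r).ne' this.symm
  have hid := h613 hd hde hq hr hqd hrd hqr
  have hv := congrArg (padicValNat ℓ) hid
  rw [padicValNat.mul (mul_ne_zero (hδ d).ne' (pow_ne_zero _ hιne)) (pow_ne_zero _ hκne),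
    padicValNat.mul (hδ d).ne' (pow_ne_zero _ hιne), padicValNat.pow, padicValNat.pow,
    padicValNat.mul (mul_ne_zero (hδ D).ne' (hcA d q).ne') (hcA D r).ne',
    padicValNat.mul (hδ D).ne' (hcA d q).ne', hvA hd hq, hvA hDsub hr, hι hd hq hqd] at hv
  omega

omit h613 hδ hι in
/-- **Cokernel terms are bounded by Tamagawa exponents**: `ord_ℓ j_q(D) ≤ ord_ℓ c_q(E)` (from (Pij)
`i·j = c_q(A_{D,M})` and (P68) at `ℓ`). [cite: PastenShimura2024, §6.6 (arXiv v4 p. 30) and Lemma 6.15 (proof, p. 31)] -/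
theorem padicValNat_coker_le {D : Finset ℕ} (hD : D ⊆ Mult) {q : ℕ} (hq : q ∈ Mult) :
    padicValNat ℓ (κ D q) ≤ padicValNat ℓ (c q) := by
  have h := hij hD hq
  have hιne : ι D q ≠ 0 := by
    intro h0; rw [h0, zero_mul] at h; exact (hcA D q).ne' h.symm
  have hκne : κ D q ≠ 0 := by
    intro h0; rw [h0, mul_zero] at h; exact (hcA D q).ne' h.symm
  have hv := congrArg (padicValNat ℓ) h
  rw [padicValNat.mul hιne hκne, hvA hD hq] at hv
  omega

/-- **Lemma 6.15 at a non-Eisenstein prime** (switching two primes of `D`): for `D = d ∪ {q, r}`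
the two expressions of (P613) give `ord_ℓ j_q(D) = ord_ℓ j_r(D)`.
[cite: PastenShimura2024, Prop. 6.13 (arXiv v4 p. 30) and Lemma 6.15 (proof, p. 31)] -/
theorem padicValNat_coker_eq_of_pair
    {d : Finset ℕ} (hd : d ⊆ Mult) (hde : Even d.card) {q r : ℕ} (hq : q ∈ Mult) (hr : r ∈ Mult)
    (hqd : q ∉ d) (hrd : r ∉ d) (hqr : q ≠ r) :
    padicValNat ℓ (κ (insert q (insert r d)) q) = padicValNat ℓ (κ (insert q (insert r d)) r) := by
  have h1 := padicValNat_step h613 hδ hcA hij hvA hι hd hde hq hr hqd hrd hqr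
  have h2 := padicValNat_step h613 hδ hcA hij hvA hι hd hde hr hq hrd hqd hqr.symm
  rw [Finset.insert_comm r q d] at h2
  omega

/-- **A (ram) witness inside `D` kills every cokernel term of level `D`**: if `ℓ₀ ∈ D` with
`ord_ℓ c_{ℓ₀}(E) = 0` then `ord_ℓ j_q(D) = 0` for all `q ∈ D` (Lemma 6.15 at `ℓ` + `j ∣ c(A)`).
[cite: PastenShimura2024, Lemma 6.15 (arXiv v4 p. 31)] -/
theorem padicValNat_coker_eq_zero_of_witness_mem
    {D : Finset ℕ} (hD : D ⊆ Mult) (hDe : Even D.card) {ℓ₀ : ℕ} (hℓ₀ : ℓ₀ ∈ D)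
    (hw : padicValNat ℓ (c ℓ₀) = 0) {q : ℕ} (hq : q ∈ D) :
    padicValNat ℓ (κ D q) = 0 := by
  by_cases hqℓ : q = ℓ₀
  · subst hqℓ
    have := padicValNat_coker_le hcA hij hvA hD (hD hq)
    omega
  · -- `D = {q, ℓ₀} ∪ d`
    set d := (D.erase q).erase ℓ₀ with hd_def
    have hdD : d ⊆ D := (Finset.erase_subset _ _).trans (Finset.erase_subset _ _)
    have hd : d ⊆ Mult := hdD.trans hD
    have hqd : q ∉ d := by
      intro h
      exact (Finset.notMem_erase q D) ((Finset.erase_subset ℓ₀ _ ) h)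
    have hℓ₀d : ℓ₀ ∉ d := Finset.notMem_erase ℓ₀ _
    have hℓ₀' : ℓ₀ ∈ D.erase q := Finset.mem_erase.mpr ⟨Ne.symm hqℓ, hℓ₀⟩
    have hDeq : insert q (insert ℓ₀ d) = D := by
      rw [hd_def, Finset.insert_erase hℓ₀', Finset.insert_erase hq]
    have hcard : D.card = d.card + 2 := by
      have h1 := Finset.card_erase_of_mem hq
      have h2 := Finset.card_erase_of_mem hℓ₀'
      have h3 : 0 < D.card := Finset.card_pos.mpr ⟨q, hq⟩
      have h4 : 0 < (D.erase q).card := Finset.card_pos.mpr ⟨ℓ₀, hℓ₀'⟩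
      rw [hd_def]; omega
    have hde : Even d.card := by
      rw [hcard] at hDe
      exact (Nat.even_add.mp hDe).mpr (by decide)
    have h := padicValNat_coker_eq_of_pair h613 hδ hcA hij hvA hι hd hde (hD hq) (hD hℓ₀) hqd hℓ₀d
      hqℓ
    rw [hDeq] at h
    have h0 := padicValNat_coker_le hcA hij hvA hD (hD hℓ₀)
    omega

/-- **Lemma 6.16 at a non-Eisenstein prime (switching a prime of `D` against two primes outside)**:
if `r ≠ t` are multiplicative primes OUTSIDE `D` (they lie in `M`) and `ord_ℓ c_r(E) = 0`, then
`ord_ℓ j_q(D) = 0` for every `q ∈ D` — the four-level identity (EqEXP1) = (EqEXP2) of Pasten (arXiv v4 p. 32)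
read at `ℓ`: `ord_ℓ j_q(D) = ord_ℓ j_r(D ∖ {q′} ∪ {r})`-type switching, then `j_r ∣ c_r(A)`. In class
X11b, `t = p` is the BSD prime itself (`p ∥ N⁺`), so only ONE (ram) witness `r = ℓ₀` is needed.
[cite: PastenShimura2024, Lemma 6.16 (proof, arXiv v4 p. 32)] -/
theorem padicValNat_coker_eq_zero_of_two_outside
    {D : Finset ℕ} (hD : D ⊆ Mult) (hDe : Even D.card) {q : ℕ} (hq : q ∈ D)
    {r t : ℕ} (hr : r ∈ Mult) (ht : t ∈ Mult) (hrD : r ∉ D) (htD : t ∉ D) (hrt : r ≠ t)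
    (hw : padicValNat ℓ (c r) = 0) :
    padicValNat ℓ (κ D q) = 0 := by
  -- a second prime `q' ∈ D`
  have hcard2 : 2 ≤ D.card := by
    have h0 : 0 < D.card := Finset.card_pos.mpr ⟨q, hq⟩
    obtain ⟨k, hk⟩ := hDe
    omega
  have hne : (D.erase q).Nonempty := by
    apply Finset.card_pos.mp
    rw [Finset.card_erase_of_mem hq]; omega
  obtain ⟨q', hq'⟩ := hne
  obtain ⟨hq'q, hq'D⟩ := Finset.mem_erase.mp hq'
  -- `D = {q, q'} ∪ d`
  set d := (D.erase q).erase q' with hd_def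
  have hdD : d ⊆ D := (Finset.erase_subset _ _).trans (Finset.erase_subset _ _)
  have hd : d ⊆ Mult := hdD.trans hD
  have hqd : q ∉ d := fun h ↦ (Finset.notMem_erase q D) ((Finset.erase_subset q' _) h)
  have hq'd : q' ∉ d := Finset.notMem_erase q' _
  have hrd : r ∉ d := fun h ↦ hrD (hdD h)
  have htd : t ∉ d := fun h ↦ htD (hdD h)
  have hDeq : insert q' (insert q d) = D := by
    rw [Finset.insert_comm, hd_def, Finset.insert_erase hq', Finset.insert_erase hq]
  have hcard : D.card = d.card + 2 := by
    have h1 := Finset.card_erase_of_mem hq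
    have h2 := Finset.card_erase_of_mem hq'
    rw [hd_def]; omega
  have hde : Even d.card := by
    rw [hcard] at hDe; exact (Nat.even_add.mp hDe).mpr (by decide)
  have hqM : q ∈ Mult := hD hq
  have hq'M : q' ∈ Mult := hD hq'D
  have hqr : q ≠ r := fun h ↦ hrD (h ▸ hq)
  have hqt : q ≠ t := fun h ↦ htD (h ▸ hq)
  have hq'r : q' ≠ r := fun h ↦ hrD (h ▸ hq'D)
  have hq't : q' ≠ t := fun h ↦ htD (h ▸ hq'D)
  -- (A) level `d → D` through the pair `(q', q)`, cokernel at `q`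
  have hA := padicValNat_step h613 hδ hcA hij hvA hι hd hde hq'M hqM hq'd hqd hq'q
  rw [hDeq] at hA
  -- (B) level `D → D₂ = D ∪ {r, t}`, cokernel at `t`
  have hB := padicValNat_step h613 hδ hcA hij hvA hι hD hDe hr ht hrD htD hrt
  -- (C) level `d → D₃ = d ∪ {q, r}`, cokernel at `r`
  have hC := padicValNat_step h613 hδ hcA hij hvA hι hd hde hqM hr hqd hrd hqr
  -- (D) level `D₃ → D₃ ∪ {q', t}`, cokernel at `t`
  have hD₃ : insert q (insert r d) ⊆ Mult :=
    Finset.insert_subset_iff.mpr ⟨hqM, Finset.insert_subset_iff.mpr ⟨hr, hd⟩⟩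
  have hD₃e : Even (insert q (insert r d)).card := by
    rw [Finset.card_insert_of_notMem (by simp [hqr, hqd]), Finset.card_insert_of_notMem hrd]
    exact (Nat.even_add.mpr (by simp [hde]))
  have hq'D₃ : q' ∉ insert q (insert r d) := by simp [hq'q, hq'r, hq'd]
  have htD₃ : t ∉ insert q (insert r d) := by simp [Ne.symm hqt, Ne.symm hrt, htd]
  have hDD := padicValNat_step h613 hδ hcA hij hvA hι hD₃ hD₃e hq'M ht hq'D₃ htD₃ hq't
  -- the two big levels coincide
  have heq : insert q' (insert t (insert q (insert r d))) = insert r (insert t D) := by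
    rw [← hDeq]
    ext x
    simp only [Finset.mem_insert]
    tauto
  rw [heq] at hDD
  -- the cokernel at `r` of level `D₃` is bounded by `c_r`
  have h0 := padicValNat_coker_le hcA hij hvA hD₃ hr (κ := κ) (ι := ι)
  omega

end Package

end Summit.BirchSwinnertonDyer.Rank1Residual.X11b.RTDegree
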